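import Mathlib
import Literature.Analysis.Calculus.TwoVariablePartials
import HarnessLib

/-!
# The energy–flux identity on characteristic trapezoids for `ψ_tt − ψ_xx + V(x)ψ = 0`

Analysis/PDE support file (everything proved, no named facts): the energy form of finite speed of
propagation for the wave equation on the line with a time-independent potential,
`ψ_tt − ψ_xx + V(x) ψ = 0`, for `C²` solutions `ψ : ℝ → ℝ → ℝ` (time first, curried, the typing of
the tree's Regge–Wheeler items). With the energy density `e = ψ_t² + ψ_x² + V ψ²` and the
characteristic trapezoid `T = {s ≤ τ ≤ t, a + τ ≤ x ≤ b − τ}` (`s ≤ t`, `a + t ≤ b − t`):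

* `trapezoid_integral_swap` — Fubini on `T` for a continuous integrand (both iterated integrals,
  as interval integrals);
* `trapezoid_energy_identity` — first-order form: if `∂_τ ψ = ψt`, `∂ₓψ = ψx`, `∂_τ ψt = ψxx − Vψ`,
  `∂_τ ψx = ψtx = ∂ₓ ψt`, `∂ₓ ψx = ψxx` (all jointly continuous, `V` continuous) then
  `∫_{a+t}^{b−t} e(t,·) − ∫_{a+s}^{b−s} e(s,·) = −∫_{a+s}^{a+t} [(ψt+ψx)² + Vψ²](x − a, x) dx − ∫_{b−t}^{b−s} [(ψt−ψx)² + Vψ²](b − x, x) dx`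
  (proof: `∂_τ e = ∂ₓ(2ψtψx)` pointwise, integrate over `T` in both orders, fundamental theorem of
  calculus in the inner variable);
* `wave1D_trapezoid_energy_identity` / `wave1D_trapezoid_energy_mono` — the same for
  `ContDiff ℝ 2 (uncurry ψ)` and the equation written with `iteratedDeriv 2` in each variable; for
  `V ≥ 0` the energy on the top of `T` is at most the energy on its base.

The half-line / two-sided exterior consequences (monotonicity of the energy outside the cone
`{ρ + |t| < |x − xc|}`) are in `Wave1DExteriorEnergy.lean`.

References: L. C. Evans, *Partial Differential Equations*, 2nd ed. (2010), §2.4.3 (domain of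
dependence by the energy method); S. Alinhac, *Hyperbolic Partial Differential Equations* (2009),
§2.2. Standard; recorded as folklore.
-/

noncomputable section

namespace Literature.Analysis.PDE

open MeasureTheory Set Filter Topology intervalIntegral Literature.Analysis.Calculus

/-! ### Fubini on a characteristic trapezoid -/

/-- The characteristic trapezoid `{s ≤ τ ≤ t, a + τ ≤ x ≤ b − τ}` of the `(τ, x)`-plane is compact. [folklore] -/
theorem isCompact_trapezoid (a b s t : ℝ) :
    IsCompact {p : ℝ × ℝ | p.1 ∈ Icc s t ∧ p.2 ∈ Icc (a + p.1) (b - p.1)} := by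
  have hclosed : IsClosed {p : ℝ × ℝ | p.1 ∈ Icc s t ∧ p.2 ∈ Icc (a + p.1) (b - p.1)} := by
    simp only [mem_Icc]
    refine IsClosed.inter (IsClosed.inter ?_ ?_) (IsClosed.inter ?_ ?_)
    · exact isClosed_le continuous_const continuous_fst
    · exact isClosed_le continuous_fst continuous_const
    · exact isClosed_le (continuous_const.add continuous_fst) continuous_snd
    · exact isClosed_le continuous_snd (continuous_const.sub continuous_fst)
  have hK : IsCompact (Icc s t ×ˢ Icc (a + s) (b - s)) := isCompact_Icc.prod isCompact_Icc
  refine hK.of_isClosed_subset hclosed ?_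
  rintro ⟨τ, x⟩ ⟨⟨h1, h2⟩, h3, h4⟩
  dsimp only at h3 h4
  exact ⟨⟨h1, h2⟩, by linarith, by linarith⟩

/-- **Fubini on a characteristic trapezoid.** For a continuous `G` on the plane, `s ≤ t` and
`a + t ≤ b − t`, integrating over the trapezoid `{s ≤ τ ≤ t, a + τ ≤ x ≤ b − τ}` first in `x` or
first in `τ` gives the same result:
`∫_s^t ∫_{a+τ}^{b−τ} G(τ,x) dx dτ = ∫_{a+s}^{b−s} ∫_s^{m(x)} G(τ,x) dτ dx`, `m(x) = min(t, x − a, b − x)`.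
[folklore] -/
theorem trapezoid_integral_swap {G : ℝ × ℝ → ℝ} (hG : Continuous G) {a b s t : ℝ} (hst : s ≤ t)
    (hab : a + t ≤ b - t) :
    ∫ τ in s..t, (∫ x in (a + τ)..(b - τ), G (τ, x))
      = ∫ x in (a + s)..(b - s), (∫ τ in s..(min t (min (x - a) (b - x))), G (τ, x)) := by
  set R : Set (ℝ × ℝ) := {p | p.1 ∈ Icc s t ∧ p.2 ∈ Icc (a + p.1) (b - p.1)} with hR
  have hRc : IsCompact R := isCompact_trapezoid a b s t
  have hRm : MeasurableSet R := hRc.isClosed.measurableSet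
  set F : ℝ × ℝ → ℝ := R.indicator G with hF
  have hFi : Integrable F ((volume : Measure ℝ).prod volume) := by
    rw [hF, integrable_indicator_iff hRm, ← Measure.volume_eq_prod]
    exact hG.continuousOn.integrableOn_compact hRc
  have hswap : ∫ τ, ∫ x, F (τ, x) = ∫ x, ∫ τ, F (τ, x) := by
    rw [← integral_prod F hFi, integral_prod_symm F hFi]
  -- the `τ`-sections
  have hsec1 : ∀ τ, (∫ x, F (τ, x)) = (Icc s t).indicator
      (fun τ => ∫ x in (a + τ)..(b - τ), G (τ, x)) τ := by
    intro τ
    by_cases hτ : τ ∈ Icc s t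
    · rw [indicator_of_mem hτ]
      have hle : a + τ ≤ b - τ := by linarith [hτ.2]
      have : (fun x => F (τ, x)) = (Icc (a + τ) (b - τ)).indicator (fun x => G (τ, x)) := by
        funext x
        by_cases hx : x ∈ Icc (a + τ) (b - τ)
        · rw [indicator_of_mem hx, hF, indicator_of_mem (show (τ, x) ∈ R from ⟨hτ, hx⟩)]
        · rw [indicator_of_notMem hx, hF, indicator_of_notMem]
          exact fun h => hx h.2
      rw [this, MeasureTheory.integral_indicator measurableSet_Icc, integral_Icc_eq_integral_Ioc,
        ← integral_of_le hle]
    · rw [indicator_of_notMem hτ]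
      have : (fun x => F (τ, x)) = fun _ => 0 := by
        funext x
        rw [hF, indicator_of_notMem]
        exact fun h => hτ h.1
      rw [this, MeasureTheory.integral_zero]
  -- the `x`-sections
  have hsec2 : ∀ x, (∫ τ, F (τ, x)) = ∫ τ in Icc s (min t (min (x - a) (b - x))), G (τ, x) := by
    intro x
    have : (fun τ => F (τ, x)) = (Icc s (min t (min (x - a) (b - x)))).indicator (fun τ => G (τ, x)) := by
      funext τ
      have hiff : (τ, x) ∈ R ↔ τ ∈ Icc s (min t (min (x - a) (b - x))) := by
        simp only [hR, mem_setOf_eq, mem_Icc, le_min_iff]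
        constructor
        · rintro ⟨⟨h1, h2⟩, h3, h4⟩; exact ⟨h1, h2, by linarith, by linarith⟩
        · rintro ⟨h1, h2, h3, h4⟩; exact ⟨⟨h1, h2⟩, by linarith, by linarith⟩
      by_cases hτ : τ ∈ Icc s (min t (min (x - a) (b - x)))
      · rw [indicator_of_mem hτ, hF, indicator_of_mem (hiff.2 hτ)]
      · rw [indicator_of_notMem hτ, hF, indicator_of_notMem (fun h => hτ (hiff.1 h))]
    rw [this, MeasureTheory.integral_indicator measurableSet_Icc]
  simp_rw [hsec1, hsec2, MeasureTheory.integral_indicator measurableSet_Icc] at hswap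
  rw [integral_Icc_eq_integral_Ioc, ← integral_of_le hst] at hswap
  rw [hswap]
  -- outside `[a + s, b - s]` the `x`-section is empty
  have hzero : ∀ x, x ∉ Icc (a + s) (b - s) →
      (∫ τ in Icc s (min t (min (x - a) (b - x))), G (τ, x)) = 0 := by
    intro x hx
    have hlt : min t (min (x - a) (b - x)) < s := by
      simp only [mem_Icc, not_and_or, not_le] at hx
      rcases hx with hx | hx
      · exact lt_of_le_of_lt (min_le_of_right_le (min_le_left _ _)) (by linarith)
      · exact lt_of_le_of_lt (min_le_of_right_le (min_le_right _ _)) (by linarith)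
    rw [Icc_eq_empty (not_le.2 hlt), Measure.restrict_empty, integral_zero_measure]
  rw [← setIntegral_eq_integral_of_forall_compl_eq_zero (s := Icc (a + s) (b - s)) hzero,
    integral_Icc_eq_integral_Ioc, ← integral_of_le (by linarith : a + s ≤ b - s)]
  refine integral_congr fun x hx => ?_
  rw [uIcc_of_le (by linarith : a + s ≤ b - s)] at hx
  have hsm : s ≤ min t (min (x - a) (b - x)) :=
    le_min hst (le_min (by linarith [hx.1]) (by linarith [hx.2]))
  rw [integral_of_le hsm, integral_Icc_eq_integral_Ioc]

/-! ### The energy identity on a characteristic trapezoid (first-order form) -/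

section EnergyIdentity

variable {V : ℝ → ℝ} {ψ ψt ψx ψtx ψxx : ℝ → ℝ → ℝ}

/-- **Energy–flux identity on a characteristic trapezoid** for the 1+1 wave equation with a
potential, first-order form. Let `ψ, ψt, ψx, ψtx, ψxx : ℝ → ℝ → ℝ` (time first) be jointly continuous
with `∂_τ ψ = ψt`, `∂ₓ ψ = ψx`, `∂_τ ψt = ψxx − V ψ` (the equation `ψ_tt − ψ_xx + V(x) ψ = 0`),
`∂_τ ψx = ψtx = ∂ₓ ψt` and `∂ₓ ψx = ψxx`, and put `e = ψt² + ψx² + V ψ²`. Then for `s ≤ t` and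
`a + t ≤ b − t`
`∫_{a+t}^{b−t} e(t,·) − ∫_{a+s}^{b−s} e(s,·) = −∫_{a+s}^{a+t} [(ψt+ψx)² + Vψ²](x−a, x) dx − ∫_{b−t}^{b−s} [(ψt−ψx)² + Vψ²](b−x, x) dx`:
the energy on the top of the trapezoid `{s ≤ τ ≤ t, a + τ ≤ x ≤ b − τ}` equals the energy on its
base minus the (signed-definite when `V ≥ 0`) fluxes through the two characteristic sides. Proof:
`∂_τ e = ∂ₓ(2 ψt ψx)` pointwise; integrate over the trapezoid in both orders
(`trapezoid_integral_swap`) and evaluate the inner integrals by the fundamental theorem of calculus.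
[folklore] -/
theorem trapezoid_energy_identity (hV : Continuous V)
    (hψ : Continuous (Function.uncurry ψ)) (hψt : Continuous (Function.uncurry ψt))
    (hψx : Continuous (Function.uncurry ψx)) (hψtx : Continuous (Function.uncurry ψtx))
    (hψxx : Continuous (Function.uncurry ψxx))
    (h1 : ∀ t x, HasDerivAt (fun τ => ψ τ x) (ψt t x) t)
    (h3 : ∀ t x, HasDerivAt (fun τ => ψt τ x) (ψxx t x - V x * ψ t x) t)
    (h4 : ∀ t x, HasDerivAt (fun τ => ψx τ x) (ψtx t x) t)
    (h5 : ∀ t x, HasDerivAt (ψt t) (ψtx t x) x)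
    (h6 : ∀ t x, HasDerivAt (ψx t) (ψxx t x) x)
    {a b s t : ℝ} (hst : s ≤ t) (hab : a + t ≤ b - t) :
    (∫ x in (a + t)..(b - t), (ψt t x ^ 2 + ψx t x ^ 2 + V x * ψ t x ^ 2))
      - ∫ x in (a + s)..(b - s), (ψt s x ^ 2 + ψx s x ^ 2 + V x * ψ s x ^ 2)
    = -(∫ x in (a + s)..(a + t), ((ψt (x - a) x + ψx (x - a) x) ^ 2 + V x * ψ (x - a) x ^ 2))
      - ∫ x in (b - t)..(b - s), ((ψt (b - x) x - ψx (b - x) x) ^ 2 + V x * ψ (b - x) x ^ 2) := by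
  -- energy density, flux and their common derivative
  set e : ℝ → ℝ → ℝ := fun τ x => ψt τ x ^ 2 + ψx τ x ^ 2 + V x * ψ τ x ^ 2 with he_def
  set fl : ℝ → ℝ → ℝ := fun τ x => 2 * (ψt τ x * ψx τ x) with hfl_def
  set g : ℝ → ℝ → ℝ := fun τ x => 2 * (ψt τ x * ψxx τ x + ψx τ x * ψtx τ x) with hg_def
  -- continuity bookkeeping
  have hcont2 : ∀ {φ : ℝ → ℝ → ℝ}, Continuous (Function.uncurry φ) →
      ∀ {u v : ℝ → ℝ}, Continuous u → Continuous v → Continuous fun y => φ (u y) (v y) :=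
    fun hφ u v hu hv => hφ.comp (hu.prodMk hv)
  have he_cont : Continuous (Function.uncurry e) := by
    have h1' := hψt; have h2' := hψx; have h3' := hψ
    show Continuous fun p : ℝ × ℝ => ψt p.1 p.2 ^ 2 + ψx p.1 p.2 ^ 2 + V p.2 * ψ p.1 p.2 ^ 2
    have ha : Continuous fun p : ℝ × ℝ => ψt p.1 p.2 := hψt
    have hb : Continuous fun p : ℝ × ℝ => ψx p.1 p.2 := hψx
    have hc : Continuous fun p : ℝ × ℝ => ψ p.1 p.2 := hψ
    have hd : Continuous fun p : ℝ × ℝ => V p.2 := hV.comp continuous_snd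
    fun_prop
  have hg_cont : Continuous (Function.uncurry g) := by
    show Continuous fun p : ℝ × ℝ => 2 * (ψt p.1 p.2 * ψxx p.1 p.2 + ψx p.1 p.2 * ψtx p.1 p.2)
    have ha : Continuous fun p : ℝ × ℝ => ψt p.1 p.2 := hψt
    have hb : Continuous fun p : ℝ × ℝ => ψx p.1 p.2 := hψx
    have hc : Continuous fun p : ℝ × ℝ => ψtx p.1 p.2 := hψtx
    have hd : Continuous fun p : ℝ × ℝ => ψxx p.1 p.2 := hψxx
    fun_prop
  have hfl_cont : Continuous (Function.uncurry fl) := by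
    show Continuous fun p : ℝ × ℝ => 2 * (ψt p.1 p.2 * ψx p.1 p.2)
    have ha : Continuous fun p : ℝ × ℝ => ψt p.1 p.2 := hψt
    have hb : Continuous fun p : ℝ × ℝ => ψx p.1 p.2 := hψx
    fun_prop
  -- pointwise: `∂_τ e = g` and `∂ₓ fl = g`
  have he_deriv : ∀ x τ, HasDerivAt (fun τ => e τ x) (g τ x) τ := by
    intro x τ
    have ha := (h3 τ x).pow 2
    have hb := (h4 τ x).pow 2
    have hc := ((h1 τ x).pow 2).const_mul (V x)
    have := (ha.add hb).add hc
    refine this.congr_deriv ?_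
    simp only [hg_def]
    push_cast
    ring
  have hfl_deriv : ∀ τ x, HasDerivAt (fun x => fl τ x) (g τ x) x := by
    intro τ x
    have := ((h5 τ x).mul (h6 τ x)).const_mul 2
    refine this.congr_deriv ?_
    simp only [hg_def]
    ring
  -- Fubini on the trapezoid for `g`
  have hswap := trapezoid_integral_swap (G := Function.uncurry g) hg_cont hst hab
  simp only [Function.uncurry_apply_pair] at hswap
  -- inner integrals by the fundamental theorem of calculus
  have hinner1 : ∀ τ, (∫ x in (a + τ)..(b - τ), g τ x) = fl τ (b - τ) - fl τ (a + τ) := by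
    intro τ
    refine integral_eq_sub_of_hasDerivAt (fun x _ => hfl_deriv τ x) ?_
    exact ((hcont2 hg_cont continuous_const continuous_id).intervalIntegrable _ _)
  have hinner2 : ∀ x m, (∫ τ in s..m, g τ x) = e m x - e s x := by
    intro x m
    refine integral_eq_sub_of_hasDerivAt (fun τ _ => he_deriv x τ) ?_
    exact ((hcont2 hg_cont continuous_id continuous_const).intervalIntegrable _ _)
  simp_rw [hinner1, hinner2] at hswap
  -- left side of `hswap`: the two characteristic fluxes, reparametrised by `x`
  have hL : (∫ τ in s..t, (fl τ (b - τ) - fl τ (a + τ)))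
      = (∫ x in (b - t)..(b - s), fl (b - x) x) - ∫ x in (a + s)..(a + t), fl (x - a) x := by
    have c1 : Continuous fun τ => fl τ (b - τ) :=
      hcont2 hfl_cont continuous_id (continuous_const.sub continuous_id)
    have c2 : Continuous fun τ => fl τ (a + τ) :=
      hcont2 hfl_cont continuous_id (continuous_const.add continuous_id)
    rw [integral_sub (c1.intervalIntegrable _ _) (c2.intervalIntegrable _ _)]
    congr 1
    · rw [← integral_comp_sub_left (fun x => fl (b - x) x) b]
      simp
    · rw [show a + s = s + a by ring, show a + t = t + a by ring,
        ← integral_comp_add_right (fun x => fl (x - a) x) a]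
      simp [add_comm]
  -- right side of `hswap`: split `[a + s, b - s]` into three pieces
  set m : ℝ → ℝ := fun x => min t (min (x - a) (b - x)) with hm_def
  have hm_cont : Continuous m := by
    simp only [hm_def]; fun_prop
  have htop_cont : Continuous fun x => e (m x) x := hcont2 he_cont hm_cont continuous_id
  have hii : ∀ u v, IntervalIntegrable (fun x => e (m x) x) volume u v :=
    fun u v => htop_cont.intervalIntegrable u v
  have hR : (∫ x in (a + s)..(b - s), (e (m x) x - e s x))
      = (∫ x in (a + s)..(a + t), e (x - a) x) + (∫ x in (a + t)..(b - t), e t x)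
        + (∫ x in (b - t)..(b - s), e (b - x) x) - ∫ x in (a + s)..(b - s), e s x := by
    have c3 : Continuous fun x => e s x := hcont2 he_cont continuous_const continuous_id
    rw [integral_sub (hii _ _) (c3.intervalIntegrable _ _)]
    congr 1
    rw [← integral_add_adjacent_intervals (hii (a + s) (a + t)) (hii (a + t) (b - s)),
      ← integral_add_adjacent_intervals (hii (a + t) (b - t)) (hii (b - t) (b - s))]
    have e1 : (∫ x in (a + s)..(a + t), e (m x) x) = ∫ x in (a + s)..(a + t), e (x - a) x := by
      refine integral_congr fun x hx => ?_
      rw [uIcc_of_le (by linarith)] at hx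
      have : m x = x - a := by
        simp only [hm_def]
        rw [min_eq_right_iff.2, min_eq_left]
        · linarith [hx.2]
        · exact min_le_of_left_le (by linarith [hx.2])
      simp only [this]
    have e2 : (∫ x in (a + t)..(b - t), e (m x) x) = ∫ x in (a + t)..(b - t), e t x := by
      refine integral_congr fun x hx => ?_
      rw [uIcc_of_le hab] at hx
      have : m x = t := by
        simp only [hm_def]
        exact min_eq_left (le_min (by linarith [hx.1]) (by linarith [hx.2]))
      simp only [this]
    have e3 : (∫ x in (b - t)..(b - s), e (m x) x) = ∫ x in (b - t)..(b - s), e (b - x) x := by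
      refine integral_congr fun x hx => ?_
      rw [uIcc_of_le (by linarith)] at hx
      have : m x = b - x := by
        simp only [hm_def]
        rw [min_eq_right_iff.2, min_eq_right]
        · linarith [hx.1]
        · exact min_le_of_right_le (by linarith [hx.1])
      simp only [this]
    rw [e1, e2, e3]
    ring
  rw [hL, hR] at hswap
  -- the goal's flux integrands are `e + fl` and `e - fl`
  have hA : (∫ x in (a + s)..(a + t), ((ψt (x - a) x + ψx (x - a) x) ^ 2 + V x * ψ (x - a) x ^ 2))
      = (∫ x in (a + s)..(a + t), e (x - a) x) + ∫ x in (a + s)..(a + t), fl (x - a) x := by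
    have c4 : Continuous fun x => e (x - a) x :=
      hcont2 he_cont (continuous_id.sub continuous_const) continuous_id
    have c5 : Continuous fun x => fl (x - a) x :=
      hcont2 hfl_cont (continuous_id.sub continuous_const) continuous_id
    rw [← integral_add (c4.intervalIntegrable _ _) (c5.intervalIntegrable _ _)]
    refine integral_congr fun x _ => ?_
    simp only [he_def, hfl_def]
    ring
  have hC : (∫ x in (b - t)..(b - s), ((ψt (b - x) x - ψx (b - x) x) ^ 2 + V x * ψ (b - x) x ^ 2))
      = (∫ x in (b - t)..(b - s), e (b - x) x) - ∫ x in (b - t)..(b - s), fl (b - x) x := by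
    have c6 : Continuous fun x => e (b - x) x :=
      hcont2 he_cont (continuous_const.sub continuous_id) continuous_id
    have c7 : Continuous fun x => fl (b - x) x :=
      hcont2 hfl_cont (continuous_const.sub continuous_id) continuous_id
    rw [← integral_sub (c6.intervalIntegrable _ _) (c7.intervalIntegrable _ _)]
    refine integral_congr fun x _ => ?_
    simp only [he_def, hfl_def]
    ring
  rw [hA, hC]
  simp only [he_def] at hswap ⊢
  linarith

end EnergyIdentity

/-! ### The energy identity and monotonicity for `C²` solutions -/

section Solutions

variable {V : ℝ → ℝ} {ψ : ℝ → ℝ → ℝ}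

/-- **Energy–flux identity on a characteristic trapezoid** for `C²` solutions of the 1+1 wave
equation with a continuous potential, `ψ_tt − ψ_xx + V(x) ψ = 0` on `ℝ²` (written with
`iteratedDeriv 2` in each variable, as in the tree's Regge–Wheeler items): with the energy density
`e(t,x) = ψ_t² + ψ_x² + V ψ²`, for `s ≤ t` and `a + t ≤ b − t`,
`∫_{a+t}^{b−t} e(t,·) − ∫_{a+s}^{b−s} e(s,·) = −∫_{a+s}^{a+t} [(ψ_t+ψ_x)² + Vψ²](x−a, x) dx − ∫_{b−t}^{b−s} [(ψ_t−ψ_x)² + Vψ²](b−x, x) dx`.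
(No sign condition on `V` is needed for the identity.) [folklore] -/
theorem wave1D_trapezoid_energy_identity (hV : Continuous V)
    (hψ : ContDiff ℝ 2 (Function.uncurry ψ))
    (hsol : ∀ t x, iteratedDeriv 2 (fun τ => ψ τ x) t - iteratedDeriv 2 (ψ t) x + V x * ψ t x = 0)
    {a b s t : ℝ} (hst : s ≤ t) (hab : a + t ≤ b - t) :
    (∫ x in (a + t)..(b - t),
        (deriv (fun τ => ψ τ x) t ^ 2 + deriv (ψ t) x ^ 2 + V x * ψ t x ^ 2))
      - ∫ x in (a + s)..(b - s),
        (deriv (fun τ => ψ τ x) s ^ 2 + deriv (ψ s) x ^ 2 + V x * ψ s x ^ 2)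
    = -(∫ x in (a + s)..(a + t), ((deriv (fun τ => ψ τ x) (x - a) + deriv (ψ (x - a)) x) ^ 2
          + V x * ψ (x - a) x ^ 2))
      - ∫ x in (b - t)..(b - s), ((deriv (fun τ => ψ τ x) (b - x) - deriv (ψ (b - x)) x) ^ 2
          + V x * ψ (b - x) x ^ 2) := by
  obtain ⟨ψt, ψx, ψtt, ψtx, ψxx, hct, hcx, -, hctx, hcxx, h1, h2, h3, h4, h5, h6, h7, h8⟩ :=
    exists_partials_of_contDiff_two hψ
  have h3' : ∀ t x, HasDerivAt (fun τ => ψt τ x) (ψxx t x - V x * ψ t x) t := by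
    intro t x
    refine (h3 t x).congr_deriv ?_
    have := hsol t x
    rw [h7, h8] at this
    linarith
  have hd1 : ∀ t x, deriv (fun τ => ψ τ x) t = ψt t x := fun t x => (h1 t x).deriv
  have hd2 : ∀ t x, deriv (ψ t) x = ψx t x := fun t x => (h2 t x).deriv
  simp only [hd1, hd2]
  exact trapezoid_energy_identity hV hψ.continuous hct hcx hctx hcxx h1 h3' h4 h5 h6 hst hab

/-- **Energy monotonicity on characteristic trapezoids** (finite speed of propagation, energy form):
for a `C²` solution of `ψ_tt − ψ_xx + V(x) ψ = 0` with continuous `V ≥ 0`, `s ≤ t` and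
`a + t ≤ b − t`, the energy `∫ (ψ_t² + ψ_x² + Vψ²)` on the top `[a + t, b − t] × {t}` of the trapezoid
is at most the energy on its base `[a + s, b − s] × {s}`. [folklore] -/
theorem wave1D_trapezoid_energy_mono (hV : Continuous V) (hV0 : ∀ x, 0 ≤ V x)
    (hψ : ContDiff ℝ 2 (Function.uncurry ψ))
    (hsol : ∀ t x, iteratedDeriv 2 (fun τ => ψ τ x) t - iteratedDeriv 2 (ψ t) x + V x * ψ t x = 0)
    {a b s t : ℝ} (hst : s ≤ t) (hab : a + t ≤ b - t) :
    (∫ x in (a + t)..(b - t),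
        (deriv (fun τ => ψ τ x) t ^ 2 + deriv (ψ t) x ^ 2 + V x * ψ t x ^ 2))
      ≤ ∫ x in (a + s)..(b - s),
        (deriv (fun τ => ψ τ x) s ^ 2 + deriv (ψ s) x ^ 2 + V x * ψ s x ^ 2) := by
  have hid := wave1D_trapezoid_energy_identity hV hψ hsol hst hab
  have hA : 0 ≤ ∫ x in (a + s)..(a + t), ((deriv (fun τ => ψ τ x) (x - a) + deriv (ψ (x - a)) x) ^ 2
      + V x * ψ (x - a) x ^ 2) :=
    intervalIntegral.integral_nonneg (by linarith) fun x _ => by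
      have := hV0 x; positivity
  have hB : 0 ≤ ∫ x in (b - t)..(b - s), ((deriv (fun τ => ψ τ x) (b - x) - deriv (ψ (b - x)) x) ^ 2
      + V x * ψ (b - x) x ^ 2) :=
    intervalIntegral.integral_nonneg (by linarith) fun x _ => by
      have := hV0 x; positivity
  linarith

end Solutions


end Literature.Analysis.PDE
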